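import Summits.SmoothPoincare4.SmoothPoincare4.Theorems.EinsteinBulkHadamardFillingStandard

/-!
# `EinsteinBulk.EinsteinHadamardFillingStandard` (item stmt-SmoothPoincare4-7999)

The Einstein form of the Hadamard-filling recognition statement follows from the general one
(`HadamardFillingStandard_proof`, item stmt-SmoothPoincare4-8000) by dropping the Einstein hypothesis.
-/

noncomputable section

-- the prescribed namespace `Summit.<P>.<Sub>.…` duplicates `SmoothPoincare4` (P = Sub)
set_option linter.dupNamespace false

open scoped Manifold ContDiff Topology
open Summit.SmoothPoincare4.SmoothPoincare4.Theses

namespace Summit.SmoothPoincare4.SmoothPoincare4.Theorems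

/-- **`EinsteinBulk.EinsteinHadamardFillingStandard`** (item stmt-SmoothPoincare4-7999): a closed
smooth `M ≃ₕ S⁴` that is the conformal infinity of a conformally compact Einstein 5-manifold with
`Rm ≤ 0` on orthonormal pairs is diffeomorphic to `S⁴` — the Einstein hypothesis is not needed
(`HadamardFillingStandard_proof`). -/
theorem EinsteinHadamardFillingStandard_proof : EinsteinBulk.EinsteinHadamardFillingStandard := by
  intro M _ _ _ _ _ _ _ _ _ he g₀ N _ _ _ _ _ g _ _hRic hpack hK
  exact HadamardFillingStandard_proof M he g₀ N g hpack hK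

end Summit.SmoothPoincare4.SmoothPoincare4.Theorems

end
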